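import Literature.Geometry.GaugeTheory.BPSTInstanton
import Literature.Geometry.GaugeTheory.AsdConnectionFlatModel
import Mathlib.Topology.UniformSpace.HeineCantor
import Mathlib.Topology.UniformSpace.UniformConvergence
import Mathlib.Analysis.Calculus.ContDiff.FiniteDimension
import HarnessLib

/-!
# Continuity of the BPST family in the `C^∞` quotient topology of `M₁(ℝ⁴)`

Topic `Literature/Geometry/GaugeTheory`; companion *proofs* file (theorems only: no definition, no
named fact) of `BPSTInstanton.lean` and `AsdModuliSpace.lean`.

`AsdModuliSpace.lean` topologises the space of connections on `P_k` by the `C^∞` topology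
(`SpOneConnection.instTopologicalSpace`: the initial topology of all jets
`A ↦ D^m(A_i ∘ φ_{x₀}⁻¹)`, valued in the spaces of functions with the topology of uniform
convergence on the compact subsets of the chart images of the patches) and the moduli space
`M_k = AsdModuliSpace` by its quotient (Donaldson–Kronheimer 1990, §4.2). This file proves the
first continuity statement for that topology in the tree: **the BPST family
`(a, λ) ↦ [A_{a,λ}] ∈ M₁(ℝ⁴)` (`BPST.instanton`) is continuous on `ℝ⁴ × (ℝ ∖ {0})`**
(`BPST.continuous_mk_instanton`, `BPST.continuous_mk_instanton_comp`), i.e. the flat case of the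
clause `ContinuousOn Ψ (univ ×ˢ Ioo 0 λ₀)` of `informationMetric_collarAsymptotics`
(`InstantonCollarInformationMetric.lean`; Groisser–Murray 1997, §3, p. 6: the collar is
parametrised continuously — indeed diffeomorphically — by centre and scale).

The proof is the textbook one: both local connection forms `A_i^{a,λ}(y)` of the BPST connection
(`BPST.regularForm`, `BPST.singularCLM`) are JOINTLY smooth in `((a, λ), y)` on
`{λ ≠ 0} × patch i` (`BPST.contDiffOn_regularForm_uncurry`, `BPST.contDiffOn_singularCLM_uncurry`);
partial jets of a jointly smooth map are jointly smooth (`contDiffAt_iteratedFDeriv_slice`, by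
induction on the order via the parametric derivative `ContDiffAt.fderiv`); a jointly continuous
map converges locally uniformly on compact sets of the second variable
(`tendstoUniformlyOn_of_continuousOn`, Heine–Cantor); and the `C^∞` topology is exactly local
uniform convergence of all jets on the compact subsets of the patches
(`BPST.continuous_connection_comp`).

## References

* S. K. Donaldson, P. B. Kronheimer, *The Geometry of Four-Manifolds* (1990), §4.2 (the topology
  of the moduli space). [DonaldsonKronheimer1990]
* D. Groisser, M. K. Murray, *Instantons and the information metric* (1997), §3, p. 6.
  [GroisserMurray1997]
* G. L. Naber, *Topology, Geometry, and Gauge Fields* (1997), §5.3 (the BPST family `A_{λ,n}`).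
  [Naber1997]
-/

noncomputable section

open scoped Manifold ContDiff Topology Quaternion UniformConvergence
open Set Function Filter
open Literature.Geometry.Riemannian (euclideanMetric)
open Literature.Topology.FourManifolds

namespace Literature.Geometry.GaugeTheory

/-! ### Generic lemmas: partial jets of jointly smooth maps; local uniform convergence -/

/-- **Partial jets of a jointly smooth map are jointly smooth**: if `Φ : P × E → F` is `C^∞` on
an open set `U`, then `(q, y) ↦ D^m_y (Φ(q, ·))(y)` is `C^∞` at every point of `U` (induction on
`m`: `D^{m+1}_y = curry ∘ ∂_y D^m_y`, and `∂_y` of a jointly smooth map is jointly smooth,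
`ContDiffAt.fderiv`). [folklore] -/
theorem contDiffAt_iteratedFDeriv_slice {P E F : Type*} [NormedAddCommGroup P] [NormedSpace ℝ P]
    [NormedAddCommGroup E] [NormedSpace ℝ E] [NormedAddCommGroup F] [NormedSpace ℝ F]
    {Φ : P × E → F} {U : Set (P × E)} (hU : IsOpen U) (hΦ : ContDiffOn ℝ ∞ Φ U) (m : ℕ)
    {z : P × E} (hz : z ∈ U) :
    ContDiffAt ℝ ∞ (fun w : P × E ↦ iteratedFDeriv ℝ m (fun y ↦ Φ (w.1, y)) w.2) z := by
  induction m generalizing z with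
  | zero =>
    have h : (fun w : P × E ↦ iteratedFDeriv ℝ 0 (fun y ↦ Φ (w.1, y)) w.2) =
        (continuousMultilinearCurryFin0 ℝ E F).symm ∘ Φ := by
      funext w
      rw [iteratedFDeriv_zero_eq_comp]
      rfl
    rw [h]
    exact (continuousMultilinearCurryFin0 ℝ E F).symm.contDiff.contDiffAt.comp z
      (hΦ.contDiffAt (hU.mem_nhds hz))
  | succ m ih =>
    have h : (fun w : P × E ↦ iteratedFDeriv ℝ (m + 1) (fun y ↦ Φ (w.1, y)) w.2) =
        fun w : P × E ↦ ((continuousMultilinearCurryLeftEquiv ℝ (fun _ : Fin (m + 1) ↦ E) F).symm :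
            (E →L[ℝ] E [×m]→L[ℝ] F) →L[ℝ] E [×(m + 1)]→L[ℝ] F)
          (fderiv ℝ (fun y ↦ iteratedFDeriv ℝ m (fun y' ↦ Φ (w.1, y')) y) w.2) := by
      funext w
      rw [iteratedFDeriv_succ_eq_comp_left]
      rfl
    rw [h]
    have hJ : ContDiffAt ℝ ∞
        (Function.uncurry fun (w : P × E) (y : E) ↦ iteratedFDeriv ℝ m (fun y' ↦ Φ (w.1, y')) y)
        (z, z.2) := by
      have h1 : ContDiffAt ℝ ∞ (fun w : (P × E) × E ↦ ((w.1.1, w.2) : P × E)) (z, z.2) :=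
        contDiffAt_fst.fst.prodMk contDiffAt_snd
      have h2 := ih (z := (z.1, z.2)) (by simpa using hz)
      exact h2.comp (z, z.2) h1
    have hK := hJ.fderiv contDiffAt_snd (show (∞ : WithTop ℕ∞) + 1 ≤ ∞ by simp)
    exact hK.continuousLinearMap_comp
      ((continuousMultilinearCurryLeftEquiv ℝ (fun _ : Fin (m + 1) ↦ E) F).symm :
        (E →L[ℝ] E [×m]→L[ℝ] F) →L[ℝ] E [×(m + 1)]→L[ℝ] F)

/-- **A jointly continuous map converges locally uniformly on compact sets of the second
variable** (Heine–Cantor): if `J` is continuous on `V × W`, `V` a neighbourhood of `q₀` in a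
locally compact space and `K ⊆ W` compact, then `J(q, ·) → J(q₀, ·)` uniformly on `K` as
`q → q₀`. [folklore] -/
theorem tendstoUniformlyOn_of_continuousOn {P E F : Type*} [UniformSpace P]
    [LocallyCompactSpace P] [UniformSpace E] [UniformSpace F] {J : P × E → F} {V : Set P}
    {W K : Set E} (hJ : ContinuousOn J (V ×ˢ W)) {q₀ : P} (hV : V ∈ 𝓝 q₀) (hK : IsCompact K)
    (hKW : K ⊆ W) :
    TendstoUniformlyOn (fun q y ↦ J (q, y)) (fun y ↦ J (q₀, y)) (𝓝 q₀) K := by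
  obtain ⟨C, hC, hCV, hCc⟩ := local_compact_nhds hV
  have hu : UniformContinuousOn (↿fun (q : P) (y : E) ↦ J (q, y)) (C ×ˢ K) :=
    (hCc.prod hK).uniformContinuousOn_of_continuous (hJ.mono (prod_mono hCV hKW))
  have h := hu.tendstoUniformlyOn (mem_of_mem_nhds hC)
  rwa [nhdsWithin_eq_nhds.2 hC] at h

/-- Uniform convergence on a set is preserved under composition of the index with a convergent
map. [folklore] -/
theorem tendstoUniformlyOn_comp_of_tendsto {ι ι' α β : Type*} [UniformSpace β] {F : ι → α → β}
    {f : α → β} {p : Filter ι} {s : Set α} (h : TendstoUniformlyOn F f p s) {p' : Filter ι'}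
    {g : ι' → ι} (hg : Tendsto g p' p) : TendstoUniformlyOn (fun n ↦ F (g n)) f p' s :=
  fun u hu ↦ hg.eventually (h u hu)

namespace BPST

/-! ### Joint smoothness of the BPST local connection forms in centre, scale and point -/

/-- **The ball-patch form `A^{a,λ}(y) = Im(conj(y - a) dy)/(λ² + |y - a|²)` is jointly `C^∞` in
`((a, λ), y)` on `{λ ≠ 0}`** (as a map into `ℝ⁴ →L[ℝ] ℍ`; componentwise, `contDiffOn_clm_apply`).
[cite: Naber1997, §4.10 Exercise 4.10.28] -/
theorem contDiffOn_regularForm_uncurry :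
    ContDiffOn ℝ ∞
      (fun w : (EuclideanSpace ℝ (Fin 4) × ℝ) × EuclideanSpace ℝ (Fin 4) ↦
        regularForm w.1.1 w.1.2 w.2)
      {w | w.1.2 ≠ 0} := by
  refine contDiffOn_clm_apply.2 fun v ↦ ?_
  have hs : ContDiffOn ℝ ∞
      (fun w : (EuclideanSpace ℝ (Fin 4) × ℝ) × EuclideanSpace ℝ (Fin 4) ↦ scale w.1.1 w.1.2 w.2)
      {w | w.1.2 ≠ 0} := by
    have h1 : ContDiff ℝ ∞ (fun w : (EuclideanSpace ℝ (Fin 4) × ℝ) × EuclideanSpace ℝ (Fin 4) ↦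
        w.1.2 ^ 2 + ‖w.2 - w.1.1‖ ^ 2) :=
      (contDiff_fst.snd.pow 2).add ((contDiff_snd.sub contDiff_fst.fst).norm_sq ℝ)
    exact h1.contDiffOn.inv fun w hw ↦ (scale_den_pos w.1.1 hw w.2).ne'
  have hp : ContDiff ℝ ∞ (fun w : (EuclideanSpace ℝ (Fin 4) × ℝ) × EuclideanSpace ℝ (Fin 4) ↦
      pairing (w.2 - w.1.1) v) :=
    (LinearMap.toContinuousLinearMap (pairing.flip v)).contDiff.comp
      (contDiff_snd.sub contDiff_fst.fst)
  exact hs.smul hp.contDiffOn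

/-- **The punctured-patch form `A₀^{a,λ} = γ A^{a,λ} γ⁻¹ - dγ γ⁻¹` is jointly `C^∞` in
`((a, λ), y)` on `{λ ≠ 0} × {y ≠ p}`** (the clutching function `γ` does not depend on the
parameters and is smooth off `p`). [cite: Naber1997, §5.2 (5.2.4)] -/
theorem contDiffOn_singularCLM_uncurry (p : EuclideanSpace ℝ (Fin 4)) :
    ContDiffOn ℝ ∞
      (fun w : (EuclideanSpace ℝ (Fin 4) × ℝ) × EuclideanSpace ℝ (Fin 4) ↦
        singularCLM w.1.1 w.1.2 p w.2)
      ({q : EuclideanSpace ℝ (Fin 4) × ℝ | q.2 ≠ 0} ×ˢ {p}ᶜ) := by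
  intro w hw
  obtain ⟨hl, hy⟩ := hw
  have hl : w.1.2 ≠ 0 := hl
  have hy : w.2 ≠ p := hy
  set γ := clutchingFun (SmoothOrientation.euclidean 4) 1 p with hγdef
  have hγ : ContDiffAt ℝ ∞ γ w.2 := contDiffAt_clutchingFun (SmoothOrientation.euclidean 4) 1 hy
  have h0 : γ w.2 ≠ 0 :=
    clutchingFun_ne_zero _ ⟨mem_patch_zero_iff.2 hy, by rw [patch_one_eq_univ]; exact mem_univ _⟩
  have hinv : ContDiffAt ℝ ∞ (fun y ↦ (γ y)⁻¹) w.2 := by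
    have hi : ContDiffAt ℝ ∞ (Inv.inv : ℍ → ℍ) (γ w.2) := by
      rw [← Ring.inverse_eq_inv']
      exact contDiffAt_ringInverse (𝕜 := ℝ) (Units.mk0 _ h0)
    exact hi.comp w.2 hγ
  have hR : ContDiffAt ℝ ∞ (fun w : (EuclideanSpace ℝ (Fin 4) × ℝ) × EuclideanSpace ℝ (Fin 4) ↦
      (ContinuousLinearMap.mul ℝ ℍ).flip (γ w.2)⁻¹) w :=
    ((ContinuousLinearMap.mul ℝ ℍ).flip.contDiff.contDiffAt.comp w.2 hinv).comp w contDiffAt_snd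
  have hL : ContDiffAt ℝ ∞ (fun w : (EuclideanSpace ℝ (Fin 4) × ℝ) × EuclideanSpace ℝ (Fin 4) ↦
      ContinuousLinearMap.mul ℝ ℍ (γ w.2)) w :=
    ((ContinuousLinearMap.mul ℝ ℍ).contDiff.contDiffAt.comp w.2 hγ).comp w contDiffAt_snd
  have hA : ContDiffAt ℝ ∞ (fun w : (EuclideanSpace ℝ (Fin 4) × ℝ) × EuclideanSpace ℝ (Fin 4) ↦
      regularForm w.1.1 w.1.2 w.2) w :=
    contDiffOn_regularForm_uncurry.contDiffAt
      ((isOpen_ne_fun (continuous_fst.snd) continuous_const).mem_nhds hl)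
  have hD : ContDiffAt ℝ ∞ (fun w : (EuclideanSpace ℝ (Fin 4) × ℝ) × EuclideanSpace ℝ (Fin 4) ↦
      fderiv ℝ γ w.2) w :=
    (hγ.fderiv_right (m := ∞) (by simp)).comp w contDiffAt_snd
  exact (((hR.clm_comp hL).clm_comp hA).sub (hR.clm_comp hD)).contDiffWithinAt

/-! ### The jets of the BPST connection -/

/-- The jet tested by the `C^∞` topology, for the ball-patch form of the BPST connection over
flat `ℝ⁴` (charts are the identity): `D^m` of `y ↦ A^{a,λ}(y)` read as a `Fin 1`-alternating map.
[folklore] -/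
theorem toFun_jet_connection_one (a p : EuclideanSpace ℝ (Fin 4)) {l : ℝ} (hl : l ≠ 0)
    (x₀ : EuclideanSpace ℝ (Fin 4)) (m : ℕ) :
    UniformOnFun.toFun (jetDomains p 1 x₀) ((connection a p hl).jet 1 x₀ m) =
      iteratedFDeriv ℝ m (fun y : EuclideanSpace ℝ (Fin 4) ↦
        ContinuousAlternatingMap.ofSubsingletonLIE (𝕜 := ℝ) (E := EuclideanSpace ℝ (Fin 4))
          (F := ℍ) (0 : Fin 1) (regularForm a l y)) := by
  show iteratedFDerivWithin ℝ m (((connection a p hl).form 1).toMForm.inChart x₀) (range (𝓡 4)) = _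
  rw [QuatOneForm.inChart_toMForm]
  simp only [ModelWithCorners.range_eq_univ, iteratedFDerivWithin_univ]
  rfl

/-- The jet tested by the `C^∞` topology, for the punctured-patch form of the BPST connection
over flat `ℝ⁴`: `D^m` of `y ↦ A₀^{a,λ}(y)` read as a `Fin 1`-alternating map. [folklore] -/
theorem toFun_jet_connection_zero (a p : EuclideanSpace ℝ (Fin 4)) {l : ℝ} (hl : l ≠ 0)
    (x₀ : EuclideanSpace ℝ (Fin 4)) (m : ℕ) :
    UniformOnFun.toFun (jetDomains p 0 x₀) ((connection a p hl).jet 0 x₀ m) =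
      iteratedFDeriv ℝ m (fun y : EuclideanSpace ℝ (Fin 4) ↦
        ContinuousAlternatingMap.ofSubsingletonLIE (𝕜 := ℝ) (E := EuclideanSpace ℝ (Fin 4))
          (F := ℍ) (0 : Fin 1) (singularCLM a l p y)) := by
  show iteratedFDerivWithin ℝ m (((connection a p hl).form 0).toMForm.inChart x₀) (range (𝓡 4)) = _
  rw [QuatOneForm.inChart_toMForm]
  simp only [ModelWithCorners.range_eq_univ, iteratedFDerivWithin_univ]
  rfl

/-- A set in `jetDomains p i x₀` over flat `ℝ⁴` is a compact subset of the patch. [folklore] -/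
theorem subset_patch_of_mem_jetDomains {p x₀ : EuclideanSpace ℝ (Fin 4)} {i : Fin 2}
    {K : Set (EuclideanSpace ℝ (Fin 4))} (hK : K ∈ jetDomains p i x₀) :
    IsCompact K ∧ K ⊆ patch p i := by
  obtain ⟨hKc, hKsub⟩ := hK
  refine ⟨hKc, fun y hy ↦ ?_⟩
  obtain ⟨x, hx, rfl⟩ := hKsub hy
  rw [extChartAt_model_space_eq_id] at hx ⊢
  exact hx.1

/-! ### Continuity of the BPST family -/

/-- **The BPST connections depend continuously on centre and scale in the `C^∞` topology**: for
every continuous `f = (a, λ) : ι → ℝ⁴ × ℝ` with `λ ≠ 0`, `t ↦ A^{f(t)}` is continuous into the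
space of connections on `P₁ → ℝ⁴` with the `C^∞` topology of `AsdModuliSpace.lean` (local uniform
convergence of all derivatives of both local connection forms on the compact subsets of the
patches). [cite: DonaldsonKronheimer1990, §4.2] -/
theorem continuous_connection_comp {ι : Type*} [TopologicalSpace ι] (p : EuclideanSpace ℝ (Fin 4))
    {f : ι → EuclideanSpace ℝ (Fin 4) × ℝ} (hf : Continuous f) (hne : ∀ t, (f t).2 ≠ 0) :
    Continuous (fun t ↦
      (connection (f t).1 p (hne t) : SpOneConnection (SmoothOrientation.euclidean 4) 1 p)) := by
  -- the parameter domain `V = {λ ≠ 0}` and the two jointly smooth local forms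
  set V : Set (EuclideanSpace ℝ (Fin 4) × ℝ) := {q | q.2 ≠ 0} with hVdef
  have hVo : IsOpen V := isOpen_ne_fun continuous_snd continuous_const
  set L := ContinuousAlternatingMap.ofSubsingletonLIE (𝕜 := ℝ) (E := EuclideanSpace ℝ (Fin 4))
    (F := ℍ) (0 : Fin 1) with hLdef
  have hΦ₁ : ContDiffOn ℝ ∞
      (fun w : (EuclideanSpace ℝ (Fin 4) × ℝ) × EuclideanSpace ℝ (Fin 4) ↦
        L (regularForm w.1.1 w.1.2 w.2)) (V ×ˢ univ) :=
    L.contDiff.comp_contDiffOn (contDiffOn_regularForm_uncurry.mono fun w hw ↦ hw.1)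
  have hΦ₀ : ContDiffOn ℝ ∞
      (fun w : (EuclideanSpace ℝ (Fin 4) × ℝ) × EuclideanSpace ℝ (Fin 4) ↦
        L (singularCLM w.1.1 w.1.2 p w.2)) (V ×ˢ {p}ᶜ) :=
    L.contDiff.comp_contDiffOn (contDiffOn_singularCLM_uncurry p)
  refine continuous_iInf_rng.2 fun i ↦ continuous_iInf_rng.2 fun x₀ ↦
    continuous_iInf_rng.2 fun m ↦ continuous_induced_rng.2 ?_
  refine continuous_iff_continuousAt.2 fun t₀ ↦ ?_
  rw [ContinuousAt, UniformOnFun.tendsto_iff_tendstoUniformlyOn]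
  intro K hK
  obtain ⟨hKc, hKW⟩ := subset_patch_of_mem_jetDomains hK
  have hVt : V ∈ 𝓝 (f t₀) := hVo.mem_nhds (hne t₀)
  have hi : i = 0 ∨ i = 1 := by fin_cases i <;> simp
  rcases hi with rfl | rfl
  · -- punctured patch: joint continuity of the partial jets on `V × {p}ᶜ`
    have hKW' : K ⊆ {p}ᶜ := fun y hy ↦ mem_patch_zero_iff.1 (hKW hy)
    have hJ : ContinuousOn
        (fun w : (EuclideanSpace ℝ (Fin 4) × ℝ) × EuclideanSpace ℝ (Fin 4) ↦
          iteratedFDeriv ℝ m (fun y ↦ L (singularCLM w.1.1 w.1.2 p y)) w.2) (V ×ˢ {p}ᶜ) :=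
      fun z hz ↦ (contDiffAt_iteratedFDeriv_slice (hVo.prod isOpen_compl_singleton) hΦ₀ m
        hz).continuousAt.continuousWithinAt
    have h3 := tendstoUniformlyOn_of_continuousOn hJ hVt hKc hKW'
    have h4 := tendstoUniformlyOn_comp_of_tendsto h3 (hf.tendsto t₀)
    show TendstoUniformlyOn
      (fun t ↦ UniformOnFun.toFun (jetDomains p 0 x₀) ((connection (f t).1 p (hne t)).jet 0 x₀ m))
      (UniformOnFun.toFun (jetDomains p 0 x₀) ((connection (f t₀).1 p (hne t₀)).jet 0 x₀ m))
      (𝓝 t₀) K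
    simp only [toFun_jet_connection_zero]
    exact h4
  · -- ball patch: joint continuity of the partial jets on `V × ℝ⁴`
    have hJ : ContinuousOn
        (fun w : (EuclideanSpace ℝ (Fin 4) × ℝ) × EuclideanSpace ℝ (Fin 4) ↦
          iteratedFDeriv ℝ m (fun y ↦ L (regularForm w.1.1 w.1.2 y)) w.2) (V ×ˢ univ) :=
      fun z hz ↦ (contDiffAt_iteratedFDeriv_slice (hVo.prod isOpen_univ) hΦ₁ m
        hz).continuousAt.continuousWithinAt
    have h3 := tendstoUniformlyOn_of_continuousOn hJ hVt hKc (subset_univ K)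
    have h4 := tendstoUniformlyOn_comp_of_tendsto h3 (hf.tendsto t₀)
    show TendstoUniformlyOn
      (fun t ↦ UniformOnFun.toFun (jetDomains p 1 x₀) ((connection (f t).1 p (hne t)).jet 1 x₀ m))
      (UniformOnFun.toFun (jetDomains p 1 x₀) ((connection (f t₀).1 p (hne t₀)).jet 1 x₀ m))
      (𝓝 t₀) K
    simp only [toFun_jet_connection_one]
    exact h4

/-- **The BPST family is continuous into the moduli space**: for every continuous
`f = (a, λ) : ι → ℝ⁴ × ℝ` with `λ ≠ 0`, `t ↦ [A^{f(t)}] ∈ M₁(ℝ⁴)` is continuous for the quotient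
`C^∞` topology of `AsdModuliSpace` — the flat case of the clause `ContinuousOn Ψ (univ ×ˢ Ioo 0 λ₀)`
of `informationMetric_collarAsymptotics` (Groisser–Murray 1997, §3, p. 6). [cite: GroisserMurray1997, §3 p. 6] -/
theorem continuous_mk_instanton_comp {ι : Type*} [TopologicalSpace ι]
    {f : ι → EuclideanSpace ℝ (Fin 4) × ℝ} (hf : Continuous f) (hne : ∀ t, (f t).2 ≠ 0) :
    Continuous (fun t ↦ AsdModuliSpace.mk
      (instanton (f t).1 (basePoint (EuclideanSpace ℝ (Fin 4))) (hne t))) :=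
  continuous_quot_mk.comp
    ((continuous_connection_comp (basePoint (EuclideanSpace ℝ (Fin 4))) hf hne).subtype_mk _)

/-- **Continuity of `(a, λ) ↦ [A_{a,λ}]` on `ℝ⁴ × (ℝ ∖ {0})`** (as a map on the subtype).
[cite: GroisserMurray1997, §3 p. 6] -/
theorem continuous_mk_instanton :
    Continuous (fun q : {q : EuclideanSpace ℝ (Fin 4) × ℝ // q.2 ≠ 0} ↦ AsdModuliSpace.mk
      (instanton q.1.1 (basePoint (EuclideanSpace ℝ (Fin 4))) q.2)) :=
  continuous_mk_instanton_comp continuous_subtype_val fun q ↦ q.2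

/-- **Continuity of `(a, λ) ↦ [A_{a,λ}]` on `ℝ⁴ × (0, ∞)`**, the parameter domain of the collar
map of `informationMetric_collarAsymptotics` (as a map on the subtype `univ ×ˢ Ioi 0`).
[cite: GroisserMurray1997, §3 p. 6] -/
theorem continuous_mk_instanton_Ioi :
    Continuous (fun q : ↥((univ : Set (EuclideanSpace ℝ (Fin 4))) ×ˢ Ioi (0 : ℝ)) ↦
      AsdModuliSpace.mk (instanton q.1.1 (basePoint (EuclideanSpace ℝ (Fin 4)))
        (mem_Ioi.1 q.2.2).ne')) :=
  continuous_mk_instanton_comp continuous_subtype_val fun q ↦ (mem_Ioi.1 q.2.2).ne'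

end BPST

end Literature.Geometry.GaugeTheory

end
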